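import Summits.NavierStokesRegularity.FunctionalMining.Candidates
import HarnessLib

/-!
# Functional mining: the typed class 𝒦₁, part 2 — K1-Q5 wiring and the palinstrophy ladder (K1-Q0(𝒫))

Search for candidate a priori estimates; no regularity claim.

Cell `pub-nsfunc`, dictionary seat (DICTIONARY.md v1.3 §14, dict/LADDER-K1Q0.md); companion of
`Candidates.lean` (split at filing for the 400-line cap; statements are the dictionary seat's v1.3
text). Contents:
* K1-Q5 wired to the prove seat's no-go criterion (`enstrophyQuadraticBudgetFalse_of_unbounded`,
  `QuadraticBudgetStatic`); the question itself is SETTLED in `Candidates.lean`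
  (`enstrophyQuadraticBudgetFalse_fin3` = `not_enstrophyQuadraticBudget`, p197294);
* K1-Q0 for the core `𝒫 = ‖Δu‖₂²`: `PalinstrophySaturatingLaw κ = SaturatingLaw 𝒫 3 (5/3) κ`,
  `PalinstrophySaturationFails` (expected FALSE);
* v1.3: the palinstrophy ladder law — `palinstrophyProduction`, `palinstrophyDissipation`, the `H²`
  balance `torusPalinstrophy_hasDerivWithinAt` (PROVED from the tree's `Hⁿ` balances), the four
  typed prover targets L1 `PalinstrophyProductionSupBound`, L2 `GradientAgmonBound`,
  L3 `PalinstrophyInterpolation`, L4 `LadderRealIneq`, the constant `palinstrophyLadderConst = κ_A`,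
  `PalinstrophyLadderLaw`, and the PROVED assembly `palinstrophyLadderLaw_of_bounds`,
  `not_palinstrophySaturationFails_of_bounds`.
Compatibility note (prove seat): `PalinstrophyRefutation.lean` (no-go #3, Sieve 1 for `𝒫`) refutes
every monomial budget of Navier–Stokes degree `< 5`; the ladder law `κ ν^{-5/3} (2ℰ) 𝒫^{4/3}` has
degree exactly `5` and is therefore NOT in the refuted class — the two files are the two sides of the
same boundary.
-/

noncomputable section

open Set MeasureTheory
open scoped InnerProductSpace RealInnerProductSpace

namespace Summit.NavierStokesRegularity.FunctionalMining

open Literature.Analysis.FunctionSpaces Literature.Analysis.FluidPDE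

variable {d : Type*} [Fintype d] [DecidableEq d]

/-! ## v1.2: K1-Q5 is wired to the tree's no-go criterion (prove seat, `QuadraticBudgetStatic`) -/

/-- **K1-Q5 from an unbounded family** (`not_enstrophyQuadraticBudget_of_unbounded`, p195806): if for
every `M` some smooth divergence-free zero-mean field `w` on `T³` with positive enstrophy production has
`M · ℰ(w)² · 𝒫(w) < σ(w)²` (`𝒫 = torusPalinstrophy = ‖Δw‖₂²`), then `EnstrophyQuadraticBudget C`
fails for every real `C`. The family (planted concentrating bumps: `σ ↦ λ³σ`, `ℰ ↦ λℰ`, `𝒫 ↦ λ³𝒫`)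
is the open CONSTRUCTION item — door D2b, typed by the no-go seat as `EnstrophyProductionUnbounded`;
the fixed three-wave field only reaches `C < 1/(768π²)`. [folklore] -/
theorem enstrophyQuadraticBudgetFalse_of_unbounded (hd : Fintype.card d = 3)
    (h : ∀ M : ℝ, ∃ w : UnitAddTorus d → EuclideanSpace ℝ d, Torus.IsSmooth w ∧ Torus.IsDivFree w ∧
      Torus.HasZeroMean w ∧ 0 < enstrophyProduction w ∧
      M * (torusEnstrophy w ^ 2 * torusPalinstrophy w) < enstrophyProduction w ^ 2) :
    EnstrophyQuadraticBudgetFalse (d := d) :=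
  fun C => not_enstrophyQuadraticBudget_of_unbounded hd h C


/-! ## v1.2: K1-Q0 for the core `𝒫` (the palinstrophy saturating law) -/

/-- **K1-Q0(𝒫): the palinstrophy saturating law `T_LD_κ(𝒫; 3, 5/3)`.** The ONLY exponents making
`d𝒫/dt ≤ κ ν^{-γ} (2ℰ) 𝒫^{1+1/σ}` dimensionally consistent on the unit torus are `σ = 3`, `γ = 5/3`
(DICTIONARY §5; `𝒫 = torusPalinstrophy = ‖Δu‖₂²`, no `½`), with closing quantity
`M_𝒫(κ) = K − (3/κ) ν^{8/3} 𝒫^{-1/3}` non-increasing. STATIC REDUCTION (DICTIONARY §14): for a smooth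
divergence-free zero-mean profile `v` with palinstrophy production `N(v) = −∫⟪Δv, Δ((v·∇)v)⟫ > 0` and
`D₃(v) = ‖∇Δv‖₂²`, amplitude/viscosity rescaling of the datum violates the law at rate constant `κ` iff
`κ < c_𝒫(v) := (3N/(8ℰ𝒫^{4/3}))·(5N/(8D₃))^{5/3}` (a scale-free profile functional), so — given the
`H²` balance and local existence, neither yet a tree lemma for `𝒫` — the optimal constant is
`C_𝒫* = sup_v c_𝒫(v)`; the census reports `c_𝒫(u(t))` along bank trajectories as calibration only.
**v1.3: DECIDED — the law HOLDS for every `κ ≥ κ_A ≈ 0.7635` (`PalinstrophyLadderLaw`,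
dict/LADDER-K1Q0.md; v1.2's "expected `C_𝒫* = ∞`" is WITHDRAWN: its heuristic ignored the
interpolation constraint `𝒫² ≤ 2ℰ‖∇Δv‖₂²`).** So `C_𝒫* ≤ κ_A` and every census value of `c_𝒫` is a
depletion measurement against `κ_A` (three-wave field: `1.06e-6` of it). Search for candidate a priori
estimates; no regularity claim — nothing is asserted. -/
def PalinstrophySaturatingLaw (κ : ℝ) : Prop :=
  SaturatingLaw (d := d) torusPalinstrophy 3 (5 / 3) κ

/-- Larger `κ` is the weaker palinstrophy law (`SaturatingLaw.mono_kappa` with `𝒫 ≥ 0`). [folklore] -/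
theorem PalinstrophySaturatingLaw.mono {κ κ' : ℝ} (h : PalinstrophySaturatingLaw (d := d) κ)
    (hκ : κ ≤ κ') : PalinstrophySaturatingLaw (d := d) κ' :=
  SaturatingLaw.mono_kappa h torusPalinstrophy_nonneg hκ

/-- **v1.2's kill target of K1-Q0(𝒫) — EXPECTED FALSE since v1.3** (kept as the settled negative
edge of the dictionary: `not_palinstrophySaturationFails_of_bounds` refutes it from the four ladder
targets below; no profile family with `c_𝒫 → ∞` exists because `c_𝒫 ≤ κ_A`). Search for candidate a
priori estimates; no regularity claim — nothing is asserted. -/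
@[conjecture] def PalinstrophySaturationFails : Prop :=
  ∀ κ : ℝ, ¬ PalinstrophySaturatingLaw (d := d) κ


/-! ## v1.3: K1-Q0(𝒫) decided — the palinstrophy ladder law (dict/LADDER-K1Q0.md)

The chain (unit torus, smooth divergence-free zero-mean `v`; `𝒫 = ‖Δv‖₂²`, `D₃ = ‖∇Δv‖₂²`,
`N = −∫⟪(v·∇)v, Δ²v⟫`, `d𝒫/dt = 2N − 2νD₃`):
(L1) `N ≤ 3·M·𝒫` whenever `|∇v|_F ≤ M` pointwise (expansion of `Δ((v·∇)v)`, the transport term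
vanishes); (L2) Agmon for the gradient, `|∇v(x)|_F² ≤ (2/π²) 𝒫^{1/2} D₃^{1/2}` (tree
`Torus.norm_sq_le_two_div_pi_sq_mul_sqrt` applied to the zero-mean fields `∂ⱼv`, Cauchy–Schwarz);
(L3) `𝒫² ≤ (2ℰ)·D₃` (Green + Cauchy–Schwarz); (L4) the real inequality
`a P^{5/4} D^{1/4} − 2νD ≤ (3/256)(5/2)^{5/3} a^{8/3} ν^{-5/3} E P^{4/3}` under `P² ≤ E·D`
(`a = 6√2/π`; two cases in `λ = (P²/E)/D_*`, `max_λ (λ^{5/4} − λ²/4) = (3/8)(5/2)^{5/3}`).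
L1–L4 are TYPED as prover targets; the assembly to the law is PROVED here. [ours — a routine
corollary of the ladder estimates of Doering–Gibbon 1995 (Thm 6.1, (6.2.25), Thm 7.4 (7.3.22)) and
Agmon's inequality (Robinson–Rodrigo–Sadowski 2016, Thm 1.20); the `N = 2` rung in this form is not
verbatim in print as far as searched — internal, unreviewed.] -/

/-- Palinstrophy production `N(v) := −∫ ⟪(v·∇)v, Δ²v⟫` — the inertial term of the `H²` balance
`d𝒫/dt = 2N − 2ν‖∇Δu‖₂²` in exactly the form the tree's `Hⁿ` balance delivers it (`n = 1`,
`Torus.IsClassicalNSSolutionOn.hasDerivWithinAt_half_integral_norm_sq_laplacian_iterate`); equals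
`−∫⟪Δv, Δ((v·∇)v)⟫` by Green. Bochner integral (junk `0`). [folklore] -/
def palinstrophyProduction (v : UnitAddTorus d → EuclideanSpace ℝ d) : ℝ :=
  -∫ x, ⟪Torus.convect v v x, Torus.laplacian (Torus.laplacian v) x⟫

/-- Palinstrophy dissipation `D₃(v) := ‖∇Δv‖₂²` (`Torus.gradNormSq` of `Δv`; `= ‖∇³v‖₂²` on the
torus). [folklore] -/
def palinstrophyDissipation (v : UnitAddTorus d → EuclideanSpace ℝ d) : ℝ :=
  Torus.gradNormSq (Torus.laplacian v)

/-- `D₃ ≥ 0`. [folklore] -/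
theorem palinstrophyDissipation_nonneg (v : UnitAddTorus d → EuclideanSpace ℝ d) :
    0 ≤ palinstrophyDissipation v :=
  Torus.gradNormSq_nonneg _

/-- **The `H²` balance for `𝒫` (v1.3, from the tree's `Hⁿ` balances).** Along a classical solution of
unforced Navier–Stokes on `T^d × [a, b]`, `a < b`, at every `t ∈ [a, b]`:
`d𝒫/dt = 2N − 2νD₃` as a one-sided derivative within `[a, b]`. [folklore] -/
theorem torusPalinstrophy_hasDerivWithinAt {a b ν : ℝ}
    {u : ℝ → UnitAddTorus d → EuclideanSpace ℝ d} {p : ℝ → UnitAddTorus d → ℝ}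
    (h : Torus.IsClassicalNSSolutionOn (Icc a b) ν 0 u p) (hab : a < b) {t : ℝ} (ht : t ∈ Icc a b) :
    HasDerivWithinAt (fun s => torusPalinstrophy (u s))
      (2 * palinstrophyProduction (u t) - 2 * ν * palinstrophyDissipation (u t)) (Icc a b) t := by
  have hder := (h.hasDerivWithinAt_half_integral_norm_sq_laplacian_iterate hab 1 ht).const_mul 2
  have i1 : ∀ v : UnitAddTorus d → EuclideanSpace ℝ d, Torus.laplacian^[1] v = Torus.laplacian v :=
    fun v => rfl
  have i2 : ∀ v : UnitAddTorus d → EuclideanSpace ℝ d,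
      Torus.laplacian^[2 * 1] v = Torus.laplacian (Torus.laplacian v) := fun v => rfl
  have hfun : (fun s => 2 * (2⁻¹ * ∫ x, ‖(Torus.laplacian^[1] (u s)) x‖ ^ 2)) =
      fun s => torusPalinstrophy (u s) := by
    funext s
    rw [i1, torusPalinstrophy]
    ring
  rw [hfun] at hder
  refine hder.congr_deriv ?_
  rw [i1, i2, palinstrophyProduction, palinstrophyDissipation]
  have hz : (fun x => ⟪Torus.convect (u t) (u t) x - (0 : ℝ → UnitAddTorus d → EuclideanSpace ℝ d) t x,
      Torus.laplacian (Torus.laplacian (u t)) x⟫) =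
      fun x => ⟪Torus.convect (u t) (u t) x, Torus.laplacian (Torus.laplacian (u t)) x⟫ := by
    funext x
    simp
  rw [hz]
  ring

/-- **Target L1 (prover; ~M-sized): production against the sup of the velocity gradient.** For smooth
divergence-free `v` on `T³` with `|∇v(x)|_F ≤ M` pointwise (Frobenius norm, `Σᵢ‖∂ᵢv(x)‖² ≤ M²`):
`N(v) ≤ 3·M·𝒫(v)`. Paper proof: `Δ((v·∇)v) = (Δv·∇)v + 2(∂ₖv·∇)∂ₖv + (v·∇)Δv`, the last term
integrates to `0` against `Δv`, the first two are bounded by `M‖Δv‖₂²` and `2M‖Δv‖₂‖∇²v‖₂ = 2M𝒫`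
(`‖∇²v‖₂ = ‖Δv‖₂` on the torus). Search for candidate a priori estimates; no regularity claim —
nothing is asserted. -/
def PalinstrophyProductionSupBound : Prop :=
  Fintype.card d = 3 → ∀ v : UnitAddTorus d → EuclideanSpace ℝ d, Torus.IsSmooth v →
    Torus.IsDivFree v → ∀ M : ℝ, 0 ≤ M → (∀ x, ∑ i, ‖Torus.partialDeriv i v x‖ ^ 2 ≤ M ^ 2) →
      palinstrophyProduction v ≤ 3 * M * torusPalinstrophy v

/-- **Target L2 (prover; S-sized): Agmon for the gradient with the tree's explicit constant.** For
smooth `v` on `T³`: `Σᵢ‖∂ᵢv(x)‖² ≤ (2/π²)·√𝒫·√D₃` for every `x` — apply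
`Torus.norm_sq_le_two_div_pi_sq_mul_sqrt` to each zero-mean field `∂ⱼv` and use Cauchy–Schwarz on the
sum (`Σⱼ‖∇∂ⱼv‖₂² = ‖Δv‖₂² = 𝒫`, `Σⱼ‖Δ∂ⱼv‖₂² = D₃`). Search for candidate a priori estimates; no
regularity claim — nothing is asserted. -/
def GradientAgmonBound : Prop :=
  Fintype.card d = 3 → ∀ v : UnitAddTorus d → EuclideanSpace ℝ d, Torus.IsSmooth v →
    ∀ x, ∑ i, ‖Torus.partialDeriv i v x‖ ^ 2 ≤
      2 / Real.pi ^ 2 * Real.sqrt (torusPalinstrophy v) * Real.sqrt (palinstrophyDissipation v)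

/-- **Target L3 (prover; S-sized): interpolation `𝒫² ≤ (2ℰ)·D₃`** (`𝒫 = −Σᵢ∫⟪∂ᵢv, ∂ᵢΔv⟫ ≤
‖∇v‖₂‖∇Δv‖₂`). Search for candidate a priori estimates; no regularity claim — nothing is asserted. -/
def PalinstrophyInterpolation : Prop :=
  ∀ v : UnitAddTorus d → EuclideanSpace ℝ d, Torus.IsSmooth v →
    torusPalinstrophy v ^ 2 ≤ 2 * torusEnstrophy v * palinstrophyDissipation v

/-- The ladder constant `κ_A := (3/256)·(5/2)^{5/3}·(6√2/π)^{8/3} = (3/4)(5/8)^{5/3}(3√2/π)^{8/3}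
≈ 0.7635280068` of the palinstrophy saturating law (dict/LADDER-K1Q0.md §2; `2^{4/3}κ_A ≈ 1.92397`
in the bank's units, dictionary.json rows P0-12/P0-12b). [folklore] -/
def palinstrophyLadderConst : ℝ :=
  3 / 256 * (5 / 2 : ℝ) ^ (5 / 3 : ℝ) * (6 * (Real.sqrt 2 / Real.pi)) ^ (8 / 3 : ℝ)

/-- **Target L4 (prover; pure real analysis, M-sized in `rpow` bookkeeping).** For reals
`P, D, E ≥ 0`, `ν > 0` with `P² ≤ E·D`:
`(6√2/π)·P^{5/4}·D^{1/4} − 2νD ≤ κ_A·ν^{-5/3}·E·P^{4/3}`. Proof (LADDER-K1Q0 §2): maximise the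
concave left side in `D` (peak `D_* ∝ ν^{-4/3}P^{5/3}`); if the constraint floor `P²/E` is below the
peak the peak value `(3/8)a^{4/3}ν^{-1/3}P^{5/3}` is within target because `E ≥ P²/D_*`, else the
left side is evaluated at the floor and the claim is `λ^{5/4} − λ²/4 ≤ (3/8)(5/2)^{5/3}`. Cheapest
falsifier: a numeric grid. Search for candidate a priori estimates; no regularity claim — nothing is
asserted (but this one is plainly decidable mathematics, expected TRUE). -/
def LadderRealIneq : Prop :=
  ∀ P D E ν : ℝ, 0 ≤ P → 0 ≤ D → 0 ≤ E → 0 < ν → P ^ 2 ≤ E * D →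
    6 * (Real.sqrt 2 / Real.pi) * P ^ (5 / 4 : ℝ) * D ^ (1 / 4 : ℝ) - 2 * ν * D ≤
      palinstrophyLadderConst * ν ^ (-(5 / 3 : ℝ)) * E * P ^ (4 / 3 : ℝ)

/-- **K1-Q0(𝒫) decided (EXPECTED TRUE; proved below from L1–L4): the palinstrophy ladder law.** The
saturating law `d𝒫/dt ≤ κ ν^{-5/3} (2ℰ) 𝒫^{4/3}` holds along every zero-mean classical solution of
unforced Navier–Stokes on `T³` for every `κ ≥ κ_A`. A small-data / a-priori-shape statement only
(TAO-BARRIER-compatible: symmetric technique); it proves nothing about regularity. Search for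
candidate a priori estimates; no regularity claim — nothing is asserted. -/
def PalinstrophyLadderLaw : Prop :=
  ∀ κ : ℝ, palinstrophyLadderConst ≤ κ → PalinstrophySaturatingLaw (d := d) κ

/-- L1 + L2 give the production bound `N ≤ 3(√2/π)·𝒫^{5/4}·D₃^{1/4}` in the squared form
`N² ≤ 9·(2/π²)·√𝒫·√D₃·𝒫²` avoided here; we use the linear form with `M := √((2/π²)√𝒫√D₃)`.
**Assembly (PROVED): L1 ∧ L2 ∧ L3 ∧ L4 ⇒ the law at `κ_A`, hence at every `κ ≥ κ_A`.** [folklore] -/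
theorem palinstrophyLadderLaw_of_bounds (h1 : PalinstrophyProductionSupBound (d := d))
    (h2 : GradientAgmonBound (d := d)) (h3 : PalinstrophyInterpolation (d := d))
    (h4 : LadderRealIneq) : PalinstrophyLadderLaw (d := d) := by
  intro κ hκ
  refine PalinstrophySaturatingLaw.mono ?_ hκ
  intro hd ν hν a b hab u p hsol hmean t ht
  have hder := torusPalinstrophy_hasDerivWithinAt hsol hab ht
  refine ⟨hder.differentiableWithinAt, ?_⟩
  rw [hder.derivWithin (uniqueDiffOn_Icc hab t ht)]
  have hsm : Torus.IsSmooth (u t) := hsol.smooth_velocity.isSmooth_slice ht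
  have hdf : Torus.IsDivFree (u t) := hsol.divFree t ht
  set P := torusPalinstrophy (u t) with hP
  set D := palinstrophyDissipation (u t) with hD
  set E := 2 * torusEnstrophy (u t) with hE
  have hP0 : 0 ≤ P := torusPalinstrophy_nonneg _
  have hD0 : 0 ≤ D := palinstrophyDissipation_nonneg _
  have hE0 : 0 ≤ E := mul_nonneg (by norm_num) (torusEnstrophy_nonneg _)
  -- L2: the pointwise gradient bound with `M² = (2/π²) √P √D`
  set M2 := 2 / Real.pi ^ 2 * Real.sqrt P * Real.sqrt D with hM2
  have hM2_nonneg : 0 ≤ M2 := by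
    have : 0 ≤ 2 / Real.pi ^ 2 := by positivity
    exact mul_nonneg (mul_nonneg this (Real.sqrt_nonneg _)) (Real.sqrt_nonneg _)
  set M := Real.sqrt M2 with hM
  have hM0 : 0 ≤ M := Real.sqrt_nonneg _
  have hMsq : M ^ 2 = M2 := Real.sq_sqrt hM2_nonneg
  have hgrad : ∀ x, ∑ i, ‖Torus.partialDeriv i (u t) x‖ ^ 2 ≤ M ^ 2 := fun x => by
    rw [hMsq]; exact h2 hd (u t) hsm x
  -- L1: N ≤ 3 M P
  have hN : palinstrophyProduction (u t) ≤ 3 * M * P := h1 hd (u t) hsm hdf M hM0 hgrad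
  -- M = (√2/π) P^{1/4} D^{1/4}
  have hMval : M = Real.sqrt 2 / Real.pi * P ^ (1 / 4 : ℝ) * D ^ (1 / 4 : ℝ) := by
    have hpi : 0 < Real.pi := Real.pi_pos
    have hsP : Real.sqrt P = P ^ (1 / 2 : ℝ) := Real.sqrt_eq_rpow P
    have hsD : Real.sqrt D = D ^ (1 / 2 : ℝ) := Real.sqrt_eq_rpow D
    have hq : ∀ y : ℝ, 0 ≤ y → Real.sqrt (y ^ (1 / 2 : ℝ)) = y ^ (1 / 4 : ℝ) := fun y hy => by
      rw [Real.sqrt_eq_rpow, ← Real.rpow_mul hy]; norm_num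
    have h2pi : Real.sqrt (2 / Real.pi ^ 2) = Real.sqrt 2 / Real.pi := by
      rw [Real.sqrt_div' _ (by positivity), Real.sqrt_sq hpi.le]
    rw [hM, hM2, hsP, hsD, Real.sqrt_mul (mul_nonneg (by positivity) (Real.rpow_nonneg hP0 _)),
      Real.sqrt_mul (by positivity), h2pi, hq P hP0, hq D hD0]
  -- 3 M P = 3 (√2/π) P^{5/4} D^{1/4}
  have h3MP : 3 * M * P = 3 * (Real.sqrt 2 / Real.pi) * P ^ (5 / 4 : ℝ) * D ^ (1 / 4 : ℝ) := by
    rw [hMval]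
    have h54 : P ^ (5 / 4 : ℝ) = P ^ (1 / 4 : ℝ) * P := by
      rw [show (5 / 4 : ℝ) = 1 / 4 + 1 by norm_num, Real.rpow_add_one' hP0 (by norm_num)]
    rw [h54]; ring
  -- L3 + L4
  have hI : P ^ 2 ≤ E * D := h3 (u t) hsm
  have hR := h4 P D E ν hP0 hD0 hE0 hν hI
  have hexp : (1 : ℝ) + (3 : ℝ)⁻¹ = 4 / 3 := by norm_num
  rw [hexp]
  linarith [hN, h3MP, hR]

/-- Corollary: L1–L4 refute v1.2's kill target `PalinstrophySaturationFails`. [folklore] -/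
theorem not_palinstrophySaturationFails_of_bounds (h1 : PalinstrophyProductionSupBound (d := d))
    (h2 : GradientAgmonBound (d := d)) (h3 : PalinstrophyInterpolation (d := d))
    (h4 : LadderRealIneq) : ¬ PalinstrophySaturationFails (d := d) := fun h =>
  h palinstrophyLadderConst (palinstrophyLadderLaw_of_bounds h1 h2 h3 h4 _ le_rfl)

end Summit.NavierStokesRegularity.FunctionalMining

end
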